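import Literature.AlgebraicGeometry.Frobenioids.PerfectionFrobeniusCompactDescent
import Literature.AlgebraicGeometry.Frobenioids.FrobeniusTypeIsotropic
import Literature.AlgebraicGeometry.Frobenioids.DivisorialDescriptionsIII
import Literature.AlgebraicGeometry.Frobenioids.IsotropicFrobenioid
import HarnessLib

/-!
# Frobenioids I, Prop. 5.5 (iii) for `C^pf`, Def. 3.1 (i)(b): the base-descent hypothesis DISCHARGED —
# `C` of standard type and group-like ⇒ `(C^pf)^istr` has a Frobenius-compact object, GIVEN Prop. 5.5 (i)

Mochizuki, *The geometry of Frobenioids I: the general theory*, Kyushu J. Math. **62** (2008) 293–400,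
Prop. 5.5 (iii) p. 104 ll. 36–37, proof p. 105 ll. 17–18 ("by assertion (i)"); Def. 3.1 (i)(b) p. 56
("if `C` is of group-like type, then `C^istr` admits a Frobenius-compact object"); Thm. 5.1 (iii) p. 97
("every Frobenius-trivial object is `Aut`-ample") [cite: MochizukiFrdI2008, Prop. 5.5 (iii) p.104].

PROOF-ONLY file (abc-iut cell, L1; sub-DAG row P55-L06 clause (b); GAP-LEDGER row G-w5d042-1; seat
abc-iut-w5-d190).  Completes `PerfectionFrobeniusCompactDescent.lean`: the base-descent hypothesis `hdesc`
of `Perfection.isFrobeniusCompact_toPf_of_baseDescent` holds at EVERY isotropic object of a GROUP-LIKE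
Frobenioid, because such an object is Frobenius-trivial in the Frobenioid `C^istr` (Prop. 1.9 (v);
`isFrobeniusTrivial_of_isGroupLikeObj_of_isOfIsotropicType`) and hence `Aut`-ample there (Thm. 5.1 (iii),
`thm51iii_frobeniusTrivial_isAutAmple`, PROVED in the tree), and `Aut`-ampleness ascends from the full
subcategory `C^istr` to `C`.  Consequently (`Perfection.hb_of_prop55i`) clause (b) of Def. 3.1 (i) for
`C^pf` — the hypothesis `hb` of `FrdI.Prop55Sub.prop55iii_pf_standard_of` (abc-iut-w5-d042) — follows from
"`C` of standard, Frobenius-isotropic and Frobenius-normalized type" and Prop. 5.5 (i) BY NAME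
(`FrdI.Prop55Sub.Prop55i F hF A`, rows P55-L01/L02), exactly print's "by assertion (i)"; and
`FrdI.Prop55Sub.prop55iii_pf_standard_of_prop55i` closes the slot `Prop55iii_pf_standard F hF` GIVEN
Prop. 3.2 (iii) (`hPf`) and Prop. 5.5 (i) by name.  No new definitions; nothing here bears on [IUTchIII]
Cor. 3.12.
-/

namespace Literature.AlgebraicGeometry.Frobenioids

open CategoryTheory

universe w v v' u u'

namespace PreFrobenioid

variable {D : Type u} [Category.{v} D] {Φ : Dᵒᵖ ⥤ CommMonCat.{w}}
  {C : Type u'} [Category.{v'} C] {F : C ⥤ ElemFrobenioid Φ}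

/-- `Aut`-ampleness ascends from the full subcategory `C^istr` to `C` (same automorphism groups, same
base). [cite: MochizukiFrdI2008, Prop. 1.9 (v) p.32] -/
theorem isAutAmple_of_isAutAmple_istr {A : C} (hA : IsIsotropic F A)
    (h : IsAutAmple (istrFunctor F) (Istr.mk A hA)) : IsAutAmple F A := by
  intro g
  obtain ⟨α, hα⟩ := h g
  exact ⟨(isotropicObjects F).ι.mapIso α, Iso.ext (congrArg Iso.hom hα)⟩

/-- **An isotropic object of a group-like Frobenioid is `Aut`-ample**: it is Frobenius-trivial in the
Frobenioid `C^istr` of isotropic type (Prop. 1.9 (v); a group-like object of a Frobenioid of isotropic type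
is Frobenius-trivial), hence `Aut`-ample there by Thm. 5.1 (iii), hence in `C`.
[cite: MochizukiFrdI2008, Thm. 5.1 (iii) p.97] -/
theorem isAutAmple_of_isGroupLikeObj_of_isIsotropic (hF : IsFrobenioid F)
    (hg : ∀ B : C, IsGroupLikeObj F B) {A : C} (hA : IsIsotropic F A) : IsAutAmple F A := by
  have hFi := isFrobenioid_istr hF
  have hft : IsFrobeniusTrivial (istrFunctor F) (Istr.mk A hA) :=
    isFrobeniusTrivial_of_isGroupLikeObj_of_isOfIsotropicType hFi isOfIsotropicType_istr (hg A)
  exact isAutAmple_of_isAutAmple_istr hA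
    (thm51iii_frobeniusTrivial_isAutAmple (istrFunctor F) hFi isOfIsotropicType_istr _ hft)

namespace Perfection

/-- **The base-descent hypothesis holds at every isotropic object of a group-like Frobenioid.**
[cite: MochizukiFrdI2008, Thm. 5.1 (iii) p.97] -/
theorem baseDescent_of_isGroupLike (hF : IsFrobenioid F) (hg : ∀ B : C, IsGroupLikeObj F B) (A : C)
    (hA : IsIsotropic F A) (c : ℕ+) (θ : Aut (frobPow hF A c)) :
    ∃ θ₀ : Aut A, Base F θ₀.hom = Base F (frob hF A c) ≫ Base F θ.hom ≫ baseInvFrob hF A c :=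
  baseDescent_of_isAutAmple hF A (isAutAmple_of_isGroupLikeObj_of_isIsotropic hF hg hA) c θ

/-- **Def. 3.1 (i)(b) for `C^pf`, GIVEN Prop. 5.5 (i)** — the hypothesis `hb` of
`FrdI.Prop55Sub.prop55iii_pf_standard_of` DISCHARGED modulo Prop. 5.5 (i) by name: for `C` of standard,
Frobenius-isotropic and Frobenius-normalized type, "if `C^pf` is of group-like type [iff `C` is], then
`(C^pf)^istr` [= `C^pf`] admits a Frobenius-compact object" — namely `(A, 1)` for the Frobenius-compact
isotropic `A` that Def. 3.1 (i)(b) provides for `C` (print p. 105 ll. 17–18: "by assertion (i)").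
[cite: MochizukiFrdI2008, Prop. 5.5 (iii) p.104] -/
theorem hb_of_prop55i (hF : IsFrobenioid F) (hiso : IsOfType (IsFrobeniusIsotropic F))
    (hnorm : IsOfType (IsFrobeniusNormalized F)) (hS : (PreFrobenioidData.ofFunctor Φ F).IsOfStandardType)
    (h55 : ∀ A : C, FrdI.Prop55Sub.Prop55i F hF A) :
    (ops hF).IsOfGroupLikeType →
      ∃ X : Perfection hF, (ops hF).IsIsotropic X ∧ (ops hF).IsFrobeniusCompact X := by
  intro hGL
  have hGLC := (isOfGroupLikeType_ops_iff hF).mp hGL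
  obtain ⟨A, hA, hcpt⟩ := hS.frobeniusCompact_of_groupLike hGLC
  have hA' : IsIsotropic F A := (PreFrobenioidData.ofFunctor_isIsotropic F A).mp hA
  have hg : ∀ B : C, IsGroupLikeObj F B := fun B =>
    (PreFrobenioidData.ofFunctor_isGroupLikeObj F B).mp (hGLC.obj B)
  exact ⟨(toPf hF).obj A, (isOfIsotropicType_perfection hF hiso).obj _,
    isFrobeniusCompact_toPf_of_baseDescent hF A hiso hnorm hA' (h55 A) hcpt
      (baseDescent_of_isGroupLike hF hg A hA')⟩

end Perfection

end PreFrobenioid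

/-- **Prop. 5.5 (iii), "standard", for `C^pf`, GIVEN Prop. 3.2 (iii) and Prop. 5.5 (i) by name** — the slot
`FrdI.Prop55Sub.Prop55iii_pf_standard F hF` with clause (b) no longer a hypothesis: all five clauses of
Def. 3.1 (i) for `Perfection.ops hF` from those of `C` (`prop55iii_pf_standard_of`, abc-iut-w5-d042) and,
for (b), `Perfection.hb_of_prop55i`. CONDITIONAL exactly on the cone nodes Prop. 3.2 (iii) (`hPf`) and
Prop. 5.5 (i) (`h55`), as print. [cite: MochizukiFrdI2008, Prop. 5.5 (iii) p.104] -/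
theorem FrdI.Prop55Sub.prop55iii_pf_standard_of_prop55i
    {D : Type u} [Category.{v} D] {Φ : Dᵒᵖ ⥤ CommMonCat.{w}} {C : Type u'} [Category.{v'} C]
    {F : C ⥤ ElemFrobenioid Φ} (hF : PreFrobenioid.IsFrobenioid F)
    (hPf : PreFrobenioid.IsFrobenioid (PreFrobenioid.Perfection.ops hF).toFunctor)
    (h55 : ∀ A : C, FrdI.Prop55Sub.Prop55i F hF A) :
    FrdI.Prop55Sub.Prop55iii_pf_standard F hF := fun hiso hnorm hS =>
  FrdI.Prop55Sub.prop55iii_pf_standard_of hF hPf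
    (PreFrobenioid.Perfection.hb_of_prop55i hF hiso hnorm hS h55) hiso hnorm hS

end Literature.AlgebraicGeometry.Frobenioids
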